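import Summits.Ventures.CertifiedManyBodySolver.Downfold.TPrimePinnedPairRowKernelBoxRows
import Summits.Ventures.CertifiedManyBodySolver.Rows.CorrWindowCertKernelChainForestTree
import HarnessLib

/-!
# The PINNED t′-PAIR shape from TWO CHAIN FORESTS (P independent sub-chains from the empty accumulator + ONE merge per vertex), «rows + halving»
# Gram slices, kernel-computed eom masks: `SquareTTPrimePinnedPairRowT.of_quotAdjForestKernelCertsGXAuto_wide` (abstract Gram with anti-Hermitian
# remainder, any outer window `Λ' ⊇ Λ₇`) and the instance-facing BOX EDITION `…of_forestTBRowsHalfAuto_box` (`TGs_v := gramTBRowsHalf K_v blocks_v`,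
# per-vertex instance CONSTANTS `D_v TH_v TE_v o_v EB_v` with `rfl` equations, as hubbard-obs-p2's single-vertex forest closer; the merged end in the
# MERGE-SCHEDULE-AGNOSTIC sum form `hsum_v`, §3 `…of_forestMergeAllTBRowsHalfAuto_box` the ONE-`mergeAllE` corollary, §4
# `…of_forestTreeTBRowsHalfAuto_box` the `MergesTo` merge-certificate corollary of hubbard-cov-la214-box-2's `Rows/CorrWindowCertKernelChainForestTree.lean`);
# cell `pub/hubbard-obs` × `pub/hubbard-downfold`, D-0154 (1)(C) COVERAGE La214; seat `hubbard-cov-la214-unc-2`, lineage desk; zero compute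

HONEST FRAMING: Lean plumbing towards «tier P» for PAIR claim nodes‴ — the T-shape PAIR twin of hubbard-obs-p2's forest closers
`CARPolyWindow.affineOrbitLowerRowN_of_quotAdjForestKernelCertGXAuto` / `…_of_forestTBRowsHalfAuto_box` (`Rows/CorrWindowCertKernelChainForest.lean`,
p689933; captain cov-la214-plan-1 g4 RULING R-g4-11 «(L6) CHAIN FOREST»). Per vertex the serial chain `(ns, M, Cs, hC0, Hs, hchain, hβ)` of
`SquareTTPrimePinnedPairRowT.of_quotAdjChainNearKernelCertsGXAuto_wide` (p685333) is replaced by a FOREST: the regrouping `ns_v`, the global hint list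
`Hs_v`, the segments `segs_v : List Seg`, `hforest_v : ForestFrom D Bkey (groupSlices (residTGslicesNear … TGs_v TH_v D.f EB (autoMasks TH_v D.f EB) ∅ ∅ CW_v
AV_v) ns_v) Hs_v 0 segs_v`, the merged end `Cfin_v` with its kernel fact `hfin_v : Cfin_v = mergeAllE Bkey (ends segs_v)`, and ONE price on `Cfin_v`;
everything else (shared tables on `Λ'`, letters, ONE eom word list, dictionaries, objective `termOp d TX_v = Γ(incl h7)(X s_v)`, rows, the Gram slots
`TGs_v TGf_v V_v hΛm_v O_v hTGf_v hG_v`, charged words, anti-Hermitian parts) as there ⟹ `SquareTTPrimePinnedPairRowT U n₀ sA sB capA capB flA flB βA κA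
κA' βB κB κB' X` via this base's `…of_residPolys_wide` (p678325). Proof per vertex = hubbard-obs-p2's forest closer lines (`forestMoves`, `forestAdj`,
`ok_of_mem_forestMoves`, licences, `evalPoly_mergeAllE` + `evalPoly_forest` + `termOp_flatten_residTGslicesNear_auto` + `termOp_residTG_moves_adj`, then
`termOp_residTG_gramX`). §2 is the BOX EDITION on `BoxGeom.boxQuot r R vmax` in the instance-facing convention of the single-vertex forest closer: per
vertex the instance's head CONSTANTS `D_v TH_v TE_v o_v` with `rfl` equations (`D_v = boxQuot r R vmax`, `TH_v = hamTermsBox R 1 s_v U`, `TE_v =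
energyTermsIdx 1 s_v U (boxIx R)`, `o_v = fun σ => orb (boxIx R 0) σ`), the two heads' eom word lists with `hEB : EB_B = EB_A`, the objective with its
semantic dictionary fact `hX_v` (own / corner objectives differ by item), `μ ν κ cap κ' fl K blocks CW hcw AV ns Hs segs hforest Cfin hfin hβ`; all sixteen
geometry facts discharged as in p682106 §3 / p685863. Nothing is asserted: no `def`, no named fact, no `sorry`, no number; no forest of record exists for
any pair vertex (nothing evaluated); CONTROL / CALIBRATION wording class (xx1); no summit statement is proved by this file.

References: X. Han, arXiv:2006.06002 §2 eq. (2), §3 [Han2020Bootstrap]; J. Wang et al., PRX 14 (2024) 031006 §III [WangEtAl2024]; C. Jansson,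
D. Chaykin, C. Keil, SIAM J. Numer. Anal. 46 (2008) 180 [JanssonChaykinKeil2008]; D. P. Bertsekas, *Nonlinear Programming* (1999) Prop. 5.1.3
[Bertsekas1999NonlinearProgramming]; O. Bratteli, D. W. Robinson, *Operator Algebras and Quantum Statistical Mechanics 2* §5.2.2
[BratteliRobinsonII1997].
-/

noncomputable section

namespace Summit.Ventures.CertifiedManyBodySolver.Downfold

open Literature.MathematicalPhysics.QuantumLattice
open Matrix HubbardWave0 Literature.Probability.LatticeModels ThermodynamicLimit Filter Topology
open Literature.MathematicalPhysics.QuantumManyBody.StateRelaxation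
open Summit.Ventures.CertifiedQuantumChemistry Summit.Ventures.CertifiedQuantumChemistry.CARPoly
open Summit.Ventures.CertifiedManyBodySolver.CARPolyWindow Summit.Ventures.CertifiedManyBodySolver.CARPolyWindow.BoxGeom
open Summit.Ventures.CertifiedManyBodySolver.Observables
open scoped BigOperators ComplexOrder

/-! ## §1 TWO chain FORESTS over eom-near sliced residuals, Gram slices with an anti-Hermitian remainder, auto masks, outer window `Λ' ⊇ Λ₇` -/

section KernelPairForestGX

variable {N Nβ : ℕ} [NeZero N]

/-- **KERNEL FORM OF THE PAIR NODE‴ — CHAIN FORESTS, «ROWS + HALVING» INPUT SHAPE, ABSTRACT GRAM WITH ANTI-HERMITIAN REMAINDER, WIDE WINDOW, AUTO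
MASKS**: as `SquareTTPrimePinnedPairRowT.of_quotAdjChainNearKernelCertsGXAuto_wide` with, per vertex, the serial chain replaced by `ns_v Hs_v segs_v
hforest_v Cfin_v hsum_v` — `hsum_v : evalPoly d (decPoly N Cfin_v) = Σ evalPoly d (decPoly N ·) over (ends segs_v)` is the MERGE-SCHEDULE-AGNOSTIC
form of the merged end (from `hfin : Cfin = mergeAllE Bkey (ends segs)` it is `by rw [hfin, evalPoly_mergeAllE]`; any merge tree / per-declaration `mergeE`
schedule with an `evalPoly` sum lemma fills it the same way) — and the price `hβ_v` on `Cfin_v`. [cite: WangEtAl2024, §III] [cite: Han2020Bootstrap, §3]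
[cite: JanssonChaykinKeil2008, §3] [cite: Bertsekas1999NonlinearProgramming, Prop. 5.1.3] [cite: BratteliRobinsonII1997, §5.2.2] -/
theorem SquareTTPrimePinnedPairRowT.of_quotAdjForestKernelCertsGXAuto_wide
    (U : ℚ) (hU : 0 ≤ U) (n₀ : ℚ) (hn0 : 0 ≤ n₀) (hn2 : n₀ < 2) (sA sB : ℚ)
    {Λ Λ' : Finset (Site 2)} (h7 : box 2 7 ⊆ Λ') (hΛ : Λ ⊆ Λ') (h8 : thicken Λ 1 ⊆ Λ')
    (h0 : thicken ({0} : Finset (Site 2)) 1 ⊆ Λ') (hz : (0 : Site 2) ∈ Λ')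
    -- tables and letters (shared)
    (D : QuotData N Nβ) (hxs : ∀ i, D.xs i ∈ Λ') (hix : ∀ y ∈ Λ', D.xs (D.ix y) = y)
    (hxsβ : ∀ j, D.xsβ j ∈ Λ) (hcovβ : ∀ x ∈ Λ, ∃ j, D.xsβ j = x)
    (d : Orb (Fin N) → Orb (PolySite Λ')) (hd : Function.Injective d)
    (hdx : ∀ i σ, d (orb i σ) = orb (PolySite.pt (D.xs i) (hxs i)) σ) (Bkey : ℕ)
    (dΛ : Orb (Fin Nβ) → Orb (PolySite Λ)) (hdΛ : ∀ j σ, dΛ (orb j σ) = orb (PolySite.pt (D.xsβ j) (hxsβ j)) σ)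
    (hf : ∀ b, d (D.f b) = Orb.embMap (PolySite.incl hΛ) (dΛ b))
    (sp : Orb (Fin N) → Fin 2) (hsp : ∀ a, (ofLex (d a)).2 = sp a)
    (hokV : ∀ γc v, D.ok γc v = true →
      ∀ j : Fin Nβ, D.xs (D.ix (d4Vec (d4OfCode γc) (D.xsβ j) + siteOfPair v)) = d4Vec (d4OfCode γc) (D.xsβ j) + siteOfPair v)
    (o : Fin 2 → Orb (Fin N)) (ho : ∀ σ, d (o σ) = orb (PolySite.pt 0 hz) σ)
    -- the objective family and the SHARED eom words
    (X : ℝ → FermionOp (box 2 7)) (EB : List (Terms (Orb (Fin Nβ))))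
    -- vertex A
    (THA : Terms (Orb (Fin N))) (hHA : termOp d THA = (hubbardTTPrimeFermionInteraction 1 (sA : ℝ) (U : ℝ)).localHamiltonian Λ')
    (TEA : Terms (Orb (Fin N)))
    (hEA : termOp d TEA = fermionEmbed (PolySite.incl h0) ((hubbardTTPrimeFermionInteraction 1 (sA : ℝ) (U : ℝ)).meanEnergyObs 1))
    (TXA : Terms (Orb (Fin N))) (hXA : termOp d TXA = fermionEmbed (PolySite.incl h7) (X (sA : ℝ)))
    (μA : Fin 2 → ℚ) (νA κA capA κA' flA : ℚ)
    (TGsA : List (Terms (Orb (Fin N)))) (TGfA VA : Terms (Orb (Fin N)))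
    {mA : Type*} [Fintype mA] [DecidableEq mA] {ΛmA : Matrix mA mA ℂ} (hΛmA : ΛmA.PosSemidef)
    (OA : mA → FermionOp Λ') (hTGfA : termOp d TGfA = gramForm ΛmA OA)
    (hGA : termOp d TGsA.flatten = termOp d TGfA - termOp d VA + (termOp d VA)ᴴ)
    (CWA : Terms (Orb (Fin N))) (hcwA : ∀ wc ∈ CWA, chargeW wc.1 ≠ 0 ∨ spinChargeW sp wc.1 ≠ 0)
    (AVA : List (Terms (Orb (Fin N))))
    (nsA : List ℕ) (HsA : List (List (QHint Nβ))) (segsA : List Seg)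
    (hforestA : ForestFrom D Bkey
      (groupSlices (residTGslicesNear TXA μA νA o κA capA κA' flA TEA TGsA THA D.f EB (autoMasks THA D.f EB)
        (fun l : Fin 0 => l.elim0) (fun l : Fin 0 => l.elim0) CWA AVA) nsA) HsA 0 segsA)
    (CfinA : SOSDual.EncPoly)
    (hsumA : evalPoly d (SOSDual.decPoly N CfinA) = ((ends segsA).map fun C => evalPoly d (SOSDual.decPoly N C)).sum)
    {βA : ℚ} (hβA : βA ≤ lowerConst (SOSDual.decPoly N CfinA) + (μA 0 + μA 1) * (n₀ / 2 - νA))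
    -- vertex B
    (THB : Terms (Orb (Fin N))) (hHB : termOp d THB = (hubbardTTPrimeFermionInteraction 1 (sB : ℝ) (U : ℝ)).localHamiltonian Λ')
    (TEB : Terms (Orb (Fin N)))
    (hEB : termOp d TEB = fermionEmbed (PolySite.incl h0) ((hubbardTTPrimeFermionInteraction 1 (sB : ℝ) (U : ℝ)).meanEnergyObs 1))
    (TXB : Terms (Orb (Fin N))) (hXB : termOp d TXB = fermionEmbed (PolySite.incl h7) (X (sB : ℝ)))
    (μB : Fin 2 → ℚ) (νB κB capB κB' flB : ℚ)
    (TGsB : List (Terms (Orb (Fin N)))) (TGfB VB : Terms (Orb (Fin N)))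
    {mB : Type*} [Fintype mB] [DecidableEq mB] {ΛmB : Matrix mB mB ℂ} (hΛmB : ΛmB.PosSemidef)
    (OB : mB → FermionOp Λ') (hTGfB : termOp d TGfB = gramForm ΛmB OB)
    (hGB : termOp d TGsB.flatten = termOp d TGfB - termOp d VB + (termOp d VB)ᴴ)
    (CWB : Terms (Orb (Fin N))) (hcwB : ∀ wc ∈ CWB, chargeW wc.1 ≠ 0 ∨ spinChargeW sp wc.1 ≠ 0)
    (AVB : List (Terms (Orb (Fin N))))
    (nsB : List ℕ) (HsB : List (List (QHint Nβ))) (segsB : List Seg)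
    (hforestB : ForestFrom D Bkey
      (groupSlices (residTGslicesNear TXB μB νB o κB capB κB' flB TEB TGsB THB D.f EB (autoMasks THB D.f EB)
        (fun l : Fin 0 => l.elim0) (fun l : Fin 0 => l.elim0) CWB AVB) nsB) HsB 0 segsB)
    (CfinB : SOSDual.EncPoly)
    (hsumB : evalPoly d (SOSDual.decPoly N CfinB) = ((ends segsB).map fun C => evalPoly d (SOSDual.decPoly N C)).sum)
    {βB : ℚ} (hβB : βB ≤ lowerConst (SOSDual.decPoly N CfinB) + (μB 0 + μB 1) * (n₀ / 2 - νB)) :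
    SquareTTPrimePinnedPairRowT (U : ℝ) (n₀ : ℝ) (sA : ℝ) (sB : ℝ) capA capB flA flB βA κA κA' βB κB κB' X := by
  -- vertex A: the accepted moves and adjoint generators of its forest, the licences, the semantic residual of the merged end
  set TsA := groupSlices (residTGslicesNear TXA μA νA o κA capA κA' flA TEA TGsA THA D.f EB (autoMasks THA D.f EB)
    (fun l : Fin 0 => l.elim0) (fun l : Fin 0 => l.elim0) CWA AVA) nsA with hTsA
  set LA := forestMoves D Bkey TsA HsA 0 segsA with hLA
  set LAA := forestAdj D Bkey TsA HsA 0 segsA with hLAA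
  have hLokA : ∀ mv ∈ LA, D.ok mv.1 mv.2.1 = true := ok_of_mem_forestMoves D Bkey TsA HsA segsA 0
  let γfA : Fin LA.length → DihedralGroup 4 := fun l => d4OfCode (LA.get l).1
  let wvfA : Fin LA.length → Site 2 := fun l => siteOfPair (LA.get l).2.1
  let gfA : Fin LA.length → Orb (Fin Nβ) → Orb (Fin N) := fun l => gq D (γfA l) (wvfA l)
  let SYfA : Fin LA.length → Terms (Orb (Fin Nβ)) := fun l => (LA.get l).2.2
  have hshA : ∀ l, d4ShiftSet (γfA l) (wvfA l) Λ ⊆ Λ' := fun l =>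
    shiftSet_subset_of_table D hxs hcovβ (γfA l) (wvfA l) (hokV _ _ (hLokA _ (List.get_mem LA l)))
  have hgA : ∀ l b, d (gfA l b) = Orb.embMap (PolySite.incl (hshA l)) (Orb.embMap (PolySite.d4Emb (γfA l) (wvfA l) Λ) (dΛ b)) :=
    fun l b => by rw [← orb_ofLex_eq b]; exact d_gq D hxs d hdx hix hxsβ dΛ hdΛ (γfA l) (wvfA l) (hshA l) _ _
  have hRA : evalPoly d (SOSDual.decPoly N CfinA) =
      termOp d (residTG TXA μA νA o κA capA κA' flA TEA TGsA.flatten THA D.f EB gfA SYfA CWA (AVA ++ LAA)) := by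
    rw [hsumA, evalPoly_forest hd D Bkey TsA HsA segsA 0 hforestA, List.drop_zero, hTsA, flatten_groupSlices,
      termOp_flatten_residTGslicesNear_auto hd TXA μA νA o κA capA κA' flA TEA _ THA D.f EB _ _ CWA AVA,
      termOp_residTG_moves_adj d TXA μA νA o κA capA κA' flA TEA _ THA D.f EB gfA SYfA CWA AVA LAA, ← hTsA, ← hLA, ← hLAA,
      termOp_symTL_eq]
  -- … the Gram remainder of vertex A moved into the adjoint family
  rw [termOp_residTG_gramX d TXA μA νA o κA capA κA' flA TEA TGsA.flatten TGfA VA hGA THA D.f EB gfA SYfA CWA (AVA ++ LAA)] at hRA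
  -- vertex B: the accepted moves and adjoint generators of its forest, the licences, the semantic residual of the merged end
  set TsB := groupSlices (residTGslicesNear TXB μB νB o κB capB κB' flB TEB TGsB THB D.f EB (autoMasks THB D.f EB)
    (fun l : Fin 0 => l.elim0) (fun l : Fin 0 => l.elim0) CWB AVB) nsB with hTsB
  set LB := forestMoves D Bkey TsB HsB 0 segsB with hLB
  set LAB := forestAdj D Bkey TsB HsB 0 segsB with hLAB
  have hLokB : ∀ mv ∈ LB, D.ok mv.1 mv.2.1 = true := ok_of_mem_forestMoves D Bkey TsB HsB segsB 0
  let γfB : Fin LB.length → DihedralGroup 4 := fun l => d4OfCode (LB.get l).1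
  let wvfB : Fin LB.length → Site 2 := fun l => siteOfPair (LB.get l).2.1
  let gfB : Fin LB.length → Orb (Fin Nβ) → Orb (Fin N) := fun l => gq D (γfB l) (wvfB l)
  let SYfB : Fin LB.length → Terms (Orb (Fin Nβ)) := fun l => (LB.get l).2.2
  have hshB : ∀ l, d4ShiftSet (γfB l) (wvfB l) Λ ⊆ Λ' := fun l =>
    shiftSet_subset_of_table D hxs hcovβ (γfB l) (wvfB l) (hokV _ _ (hLokB _ (List.get_mem LB l)))
  have hgB : ∀ l b, d (gfB l b) = Orb.embMap (PolySite.incl (hshB l)) (Orb.embMap (PolySite.d4Emb (γfB l) (wvfB l) Λ) (dΛ b)) :=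
    fun l b => by rw [← orb_ofLex_eq b]; exact d_gq D hxs d hdx hix hxsβ dΛ hdΛ (γfB l) (wvfB l) (hshB l) _ _
  have hRB : evalPoly d (SOSDual.decPoly N CfinB) =
      termOp d (residTG TXB μB νB o κB capB κB' flB TEB TGsB.flatten THB D.f EB gfB SYfB CWB (AVB ++ LAB)) := by
    rw [hsumB, evalPoly_forest hd D Bkey TsB HsB segsB 0 hforestB, List.drop_zero, hTsB, flatten_groupSlices,
      termOp_flatten_residTGslicesNear_auto hd TXB μB νB o κB capB κB' flB TEB _ THB D.f EB _ _ CWB AVB,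
      termOp_residTG_moves_adj d TXB μB νB o κB capB κB' flB TEB _ THB D.f EB gfB SYfB CWB AVB LAB, ← hTsB, ← hLB, ← hLAB,
      termOp_symTL_eq]
  -- … the Gram remainder of vertex B moved into the adjoint family
  rw [termOp_residTG_gramX d TXB μB νB o κB capB κB' flB TEB TGsB.flatten TGfB VB hGB THB D.f EB gfB SYfB CWB (AVB ++ LAB)] at hRB
  exact SquareTTPrimePinnedPairRowT.of_residPolys_wide U hU n₀ hn0 hn2 sA sB h7 hΛ h8 h0 hz d dΛ D.f hf sp hsp o ho X EB
    THA hHA TEA hEA TXA hXA μA νA κA capA κA' flA TGfA hΛmA OA hTGfA γfA wvfA hshA gfA hgA SYfA CWA hcwA ((AVA ++ LAA) ++ [VA]) hRA hβA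
    THB hHB TEB hEB TXB hXB μB νB κB capB κB' flB TGfB hΛmB OB hTGfB γfB wvfB hshB gfB hgB SYfB CWB hcwB ((AVB ++ LAB) ++ [VB]) hRB hβB

end KernelPairForestGX

/-! ## §2 THE BOX EDITION, chain forests, two-level Gram by HALF ROWS, auto masks, instance CONSTANTS with `rfl` equations -/

section KernelPairForestBox

/-- **KERNEL FORM OF THE PAIR NODE‴ ON THE BOX GEOMETRY OF RECORD — CHAIN FORESTS, HALF-ROW GRAM, AUTO MASKS, HEAD CONSTANTS.** Shared: `(r, R,
vmax)` with `7 ≤ R`, `r + 1 ≤ R`, `r + vmax ≤ R`, the station `(U, n₀)`, hoppings `sA sB`, `Bkey`, the objective family `X`, the two heads' eom word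
lists `EB_A`, `EB_B` with `hEB : EB_B = EB_A`; per vertex v the instance's head constants `D_v` (`= boxQuot r R vmax`), `TH_v` (`= hamTermsBox R 1 s_v
U`), `TE_v` (`= energyTermsIdx 1 s_v U (boxIx R)`), `o_v` (`= fun σ => orb (boxIx R 0) σ`) with those `rfl` equations, the objective `TX_v` with `hX_v :
termOp (boxD R) TX_v = Γ(incl)(X s_v)` (`termOp_boxD_fsumTermsIdx{_cast}`), rows `μ ν κ cap κ' fl`, Gram data `K blocks` (`TGs_v := gramTBRowsHalf K_v
blocks_v`; PSD-ness and the remainder discharged here), `CW hcw AV`, the forest `ns Hs segs hforest Cfin hsum` (merge-schedule-agnostic sum form; §3 = the `mergeAllE` corollary), and the price `hβ` on `Cfin`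
⟹ `SquareTTPrimePinnedPairRowT U n₀ sA sB capA capB flA flB βA κA κA' βB κB κB' X`. [cite: WangEtAl2024, §III] [cite: Han2020Bootstrap, §2 eq. (2)]
[cite: JanssonChaykinKeil2008, §3] -/
theorem SquareTTPrimePinnedPairRowT.of_forestTBRowsHalfAuto_box
    (r R vmax : ℕ) (h7R : 7 ≤ R) (hrR : r + 1 ≤ R) (hvR : r + vmax ≤ R)
    (U : ℚ) (hU : 0 ≤ U) (n₀ : ℚ) (hn0 : 0 ≤ n₀) (hn2 : n₀ < 2) (sA sB : ℚ) (Bkey : ℕ)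
    (X : ℝ → FermionOp (box 2 7))
    (EBA EBB : List (Terms (Orb (Fin (boxN r))))) (hEB : EBB = EBA)
    -- vertex A
    (DA : QuotData (boxN R) (boxN r)) (hDA : DA = boxQuot r R vmax)
    (THA : Terms (Orb (Fin (boxN R)))) (hTHA : THA = hamTermsBox R 1 sA U)
    (TEA : Terms (Orb (Fin (boxN R)))) (hTEA : TEA = energyTermsIdx 1 sA U (boxIx R))
    (oA : Fin 2 → Orb (Fin (boxN R))) (hoA : oA = fun σ => orb (boxIx R 0) σ)
    (TXA : Terms (Orb (Fin (boxN R)))) (hXA : termOp (boxD R) TXA = fermionEmbed (PolySite.incl (box_subset_boxW h7R)) (X (sA : ℝ)))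
    (μA : Fin 2 → ℚ) (νA κA capA κA' flA : ℚ)
    (KA : ℕ) (blocksA : List (List (List ℤ × Terms (Orb (Fin (boxN R))))))
    (CWA : Terms (Orb (Fin (boxN R)))) (hcwA : ∀ wc ∈ CWA, chargeW wc.1 ≠ 0 ∨ spinChargeW (fun a => (ofLex a).2) wc.1 ≠ 0)
    (AVA : List (Terms (Orb (Fin (boxN R)))))
    (nsA : List ℕ) (HsA : List (List (QHint (boxN r)))) (segsA : List Seg)
    (hforestA : ForestFrom DA Bkey
      (groupSlices (residTGslicesNear TXA μA νA oA κA capA κA' flA TEA (gramTBRowsHalf KA blocksA) THA DA.f EBA (autoMasks THA DA.f EBA)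
        (fun l : Fin 0 => l.elim0) (fun l : Fin 0 => l.elim0) CWA AVA) nsA) HsA 0 segsA)
    (CfinA : SOSDual.EncPoly)
    (hsumA : haveI := neZero_boxN R; evalPoly (boxD R) (SOSDual.decPoly (boxN R) CfinA) =
      ((ends segsA).map fun C => evalPoly (boxD R) (SOSDual.decPoly (boxN R) C)).sum)
    {βA : ℚ}
    (hβA : haveI := neZero_boxN R; βA ≤ lowerConst (SOSDual.decPoly (boxN R) CfinA) + (μA 0 + μA 1) * (n₀ / 2 - νA))
    -- vertex B
    (DB : QuotData (boxN R) (boxN r)) (hDB : DB = boxQuot r R vmax)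
    (THB : Terms (Orb (Fin (boxN R)))) (hTHB : THB = hamTermsBox R 1 sB U)
    (TEB : Terms (Orb (Fin (boxN R)))) (hTEB : TEB = energyTermsIdx 1 sB U (boxIx R))
    (oB : Fin 2 → Orb (Fin (boxN R))) (hoB : oB = fun σ => orb (boxIx R 0) σ)
    (TXB : Terms (Orb (Fin (boxN R)))) (hXB : termOp (boxD R) TXB = fermionEmbed (PolySite.incl (box_subset_boxW h7R)) (X (sB : ℝ)))
    (μB : Fin 2 → ℚ) (νB κB capB κB' flB : ℚ)
    (KB : ℕ) (blocksB : List (List (List ℤ × Terms (Orb (Fin (boxN R))))))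
    (CWB : Terms (Orb (Fin (boxN R)))) (hcwB : ∀ wc ∈ CWB, chargeW wc.1 ≠ 0 ∨ spinChargeW (fun a => (ofLex a).2) wc.1 ≠ 0)
    (AVB : List (Terms (Orb (Fin (boxN R)))))
    (nsB : List ℕ) (HsB : List (List (QHint (boxN r)))) (segsB : List Seg)
    (hforestB : ForestFrom DB Bkey
      (groupSlices (residTGslicesNear TXB μB νB oB κB capB κB' flB TEB (gramTBRowsHalf KB blocksB) THB DB.f EBB (autoMasks THB DB.f EBB)
        (fun l : Fin 0 => l.elim0) (fun l : Fin 0 => l.elim0) CWB AVB) nsB) HsB 0 segsB)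
    (CfinB : SOSDual.EncPoly)
    (hsumB : haveI := neZero_boxN R; evalPoly (boxD R) (SOSDual.decPoly (boxN R) CfinB) =
      ((ends segsB).map fun C => evalPoly (boxD R) (SOSDual.decPoly (boxN R) C)).sum)
    {βB : ℚ}
    (hβB : haveI := neZero_boxN R; βB ≤ lowerConst (SOSDual.decPoly (boxN R) CfinB) + (μB 0 + μB 1) * (n₀ / 2 - νB))
    : SquareTTPrimePinnedPairRowT (U : ℝ) (n₀ : ℝ) (sA : ℝ) (sB : ℝ) capA capB flA flB βA κA κA' βB κB κB' X := by
  haveI : NeZero (boxN R) := neZero_boxN R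
  subst EBB hDA hDB hTHA hTHB hTEA hTEB hoA hoB
  have hrR' : r ≤ R := by omega
  have h1R : 1 ≤ R := le_trans (by norm_num) h7R
  exact SquareTTPrimePinnedPairRowT.of_quotAdjForestKernelCertsGXAuto_wide U hU n₀ hn0 hn2 sA sB (box_subset_boxW h7R) (boxW_mono hrR')
    (thicken_boxW_subset_boxW hrR) (thicken01_subset_boxW h1R) (zero_mem_boxW R)
    (boxQuot r R vmax) (boxXs_mem R) (fun y hy => boxXs_boxIx R y hy) (boxXs_mem r) (boxQuot_hcovβ r R vmax)
    (boxD R) (boxD_injective R) (boxD_orb R) Bkey (boxD r) (boxQuot_hdΛ r R vmax) (fun b => boxD_boxPush hrR' b)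
    (fun a => (ofLex a).2) (boxD_spin R) (fun γc v hok j => box_hokV hvR γc v hok j) (fun σ => orb (boxIx R 0) σ) (boxD_orb_boxIx_zero R) X EBA
    (hamTermsBox R 1 sA U) (termOp_boxD_hamTermsBox R sA U) (energyTermsIdx 1 sA U (boxIx R)) (termOp_boxD_energyTermsIdx h1R sA U)
    TXA hXA μA νA κA capA κA' flA (gramTBRowsHalf KA blocksA) (gramTB KA blocksA) (lowerTB KA blocksA)
    (gramTBCoef_posSemidef KA blocksA) (gramTBOp (boxD R) blocksA) (termOp_gramTB_eq_gramForm (boxD R) KA blocksA)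
    (termOp_flatten_gramTBRowsHalf (boxD R) KA blocksA) CWA hcwA AVA nsA HsA segsA hforestA CfinA hsumA hβA
    (hamTermsBox R 1 sB U) (termOp_boxD_hamTermsBox R sB U) (energyTermsIdx 1 sB U (boxIx R)) (termOp_boxD_energyTermsIdx h1R sB U)
    TXB hXB μB νB κB capB κB' flB (gramTBRowsHalf KB blocksB) (gramTB KB blocksB) (lowerTB KB blocksB)
    (gramTBCoef_posSemidef KB blocksB) (gramTBOp (boxD R) blocksB) (termOp_gramTB_eq_gramForm (boxD R) KB blocksB)
    (termOp_flatten_gramTBRowsHalf (boxD R) KB blocksB) CWB hcwB AVB nsB HsB segsB hforestB CfinB hsumB hβB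

end KernelPairForestBox

/-! ## §3 The `mergeAllE` corollary (the merged end named by ONE `mergeAllE` fact, as hubbard-obs-p2's `…_of_forestTBRowsHalfAuto_box`) -/

section KernelPairForestMergeAll

/-- **KERNEL FORM OF THE PAIR NODE‴ ON THE BOX GEOMETRY OF RECORD — CHAIN FORESTS WITH ONE `mergeAllE` PER VERTEX**: as
`SquareTTPrimePinnedPairRowT.of_forestTBRowsHalfAuto_box` with `hsum_v` replaced by the kernel fact `hfin_v : Cfin_v = mergeAllE Bkey (ends segs_v)`
(`evalPoly_mergeAllE`). [cite: WangEtAl2024, §III] [cite: JanssonChaykinKeil2008, §3] -/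
theorem SquareTTPrimePinnedPairRowT.of_forestMergeAllTBRowsHalfAuto_box
    (r R vmax : ℕ) (h7R : 7 ≤ R) (hrR : r + 1 ≤ R) (hvR : r + vmax ≤ R)
    (U : ℚ) (hU : 0 ≤ U) (n₀ : ℚ) (hn0 : 0 ≤ n₀) (hn2 : n₀ < 2) (sA sB : ℚ) (Bkey : ℕ)
    (X : ℝ → FermionOp (box 2 7))
    (EBA EBB : List (Terms (Orb (Fin (boxN r))))) (hEB : EBB = EBA)
    -- vertex A
    (DA : QuotData (boxN R) (boxN r)) (hDA : DA = boxQuot r R vmax)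
    (THA : Terms (Orb (Fin (boxN R)))) (hTHA : THA = hamTermsBox R 1 sA U)
    (TEA : Terms (Orb (Fin (boxN R)))) (hTEA : TEA = energyTermsIdx 1 sA U (boxIx R))
    (oA : Fin 2 → Orb (Fin (boxN R))) (hoA : oA = fun σ => orb (boxIx R 0) σ)
    (TXA : Terms (Orb (Fin (boxN R)))) (hXA : termOp (boxD R) TXA = fermionEmbed (PolySite.incl (box_subset_boxW h7R)) (X (sA : ℝ)))
    (μA : Fin 2 → ℚ) (νA κA capA κA' flA : ℚ)
    (KA : ℕ) (blocksA : List (List (List ℤ × Terms (Orb (Fin (boxN R))))))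
    (CWA : Terms (Orb (Fin (boxN R)))) (hcwA : ∀ wc ∈ CWA, chargeW wc.1 ≠ 0 ∨ spinChargeW (fun a => (ofLex a).2) wc.1 ≠ 0)
    (AVA : List (Terms (Orb (Fin (boxN R)))))
    (nsA : List ℕ) (HsA : List (List (QHint (boxN r)))) (segsA : List Seg)
    (hforestA : ForestFrom DA Bkey
      (groupSlices (residTGslicesNear TXA μA νA oA κA capA κA' flA TEA (gramTBRowsHalf KA blocksA) THA DA.f EBA (autoMasks THA DA.f EBA)
        (fun l : Fin 0 => l.elim0) (fun l : Fin 0 => l.elim0) CWA AVA) nsA) HsA 0 segsA)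
    (CfinA : SOSDual.EncPoly) (hfinA : CfinA = mergeAllE Bkey (ends segsA))
    {βA : ℚ}
    (hβA : haveI := neZero_boxN R; βA ≤ lowerConst (SOSDual.decPoly (boxN R) CfinA) + (μA 0 + μA 1) * (n₀ / 2 - νA))
    -- vertex B
    (DB : QuotData (boxN R) (boxN r)) (hDB : DB = boxQuot r R vmax)
    (THB : Terms (Orb (Fin (boxN R)))) (hTHB : THB = hamTermsBox R 1 sB U)
    (TEB : Terms (Orb (Fin (boxN R)))) (hTEB : TEB = energyTermsIdx 1 sB U (boxIx R))
    (oB : Fin 2 → Orb (Fin (boxN R))) (hoB : oB = fun σ => orb (boxIx R 0) σ)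
    (TXB : Terms (Orb (Fin (boxN R)))) (hXB : termOp (boxD R) TXB = fermionEmbed (PolySite.incl (box_subset_boxW h7R)) (X (sB : ℝ)))
    (μB : Fin 2 → ℚ) (νB κB capB κB' flB : ℚ)
    (KB : ℕ) (blocksB : List (List (List ℤ × Terms (Orb (Fin (boxN R))))))
    (CWB : Terms (Orb (Fin (boxN R)))) (hcwB : ∀ wc ∈ CWB, chargeW wc.1 ≠ 0 ∨ spinChargeW (fun a => (ofLex a).2) wc.1 ≠ 0)
    (AVB : List (Terms (Orb (Fin (boxN R)))))
    (nsB : List ℕ) (HsB : List (List (QHint (boxN r)))) (segsB : List Seg)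
    (hforestB : ForestFrom DB Bkey
      (groupSlices (residTGslicesNear TXB μB νB oB κB capB κB' flB TEB (gramTBRowsHalf KB blocksB) THB DB.f EBB (autoMasks THB DB.f EBB)
        (fun l : Fin 0 => l.elim0) (fun l : Fin 0 => l.elim0) CWB AVB) nsB) HsB 0 segsB)
    (CfinB : SOSDual.EncPoly) (hfinB : CfinB = mergeAllE Bkey (ends segsB))
    {βB : ℚ}
    (hβB : haveI := neZero_boxN R; βB ≤ lowerConst (SOSDual.decPoly (boxN R) CfinB) + (μB 0 + μB 1) * (n₀ / 2 - νB))
    : SquareTTPrimePinnedPairRowT (U : ℝ) (n₀ : ℝ) (sA : ℝ) (sB : ℝ) capA capB flA flB βA κA κA' βB κB κB' X := by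
  haveI : NeZero (boxN R) := neZero_boxN R
  exact SquareTTPrimePinnedPairRowT.of_forestTBRowsHalfAuto_box r R vmax h7R hrR hvR U hU n₀ hn0 hn2 sA sB Bkey X EBA EBB hEB
    DA hDA THA hTHA TEA hTEA oA hoA TXA hXA μA νA κA capA κA' flA KA blocksA CWA hcwA AVA nsA HsA segsA hforestA CfinA
    (by rw [hfinA, evalPoly_mergeAllE]) hβA
    DB hDB THB hTHB TEB hTEB oB hoB TXB hXB μB νB κB capB κB' flB KB blocksB CWB hcwB AVB nsB HsB segsB hforestB CfinB
    (by rw [hfinB, evalPoly_mergeAllE]) hβB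

end KernelPairForestMergeAll

/-! ## §4 The MERGE-TREE corollary (the merged end certified by a `MergesTo` term — flat forests + binary / single-`mergeE` trees, hubbard-cov-la214-box-2's
`Rows/CorrWindowCertKernelChainForestTree.lean`; binder-compatible with its `…_of_forestTreeTBRowsHalfAuto_box`) -/

section KernelPairForestTree

/-- **KERNEL FORM OF THE PAIR NODE‴ ON THE BOX GEOMETRY OF RECORD — CHAIN FORESTS WITH A MERGE CERTIFICATE PER VERTEX**: as
`SquareTTPrimePinnedPairRowT.of_forestTBRowsHalfAuto_box` with `hsum_v` replaced by `hfin_v : MergesTo Bkey (ends segs_v) Cfin_v` (`MergesTo.evalPoly_eq`).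
[cite: WangEtAl2024, §III] [cite: JanssonChaykinKeil2008, §3] -/
theorem SquareTTPrimePinnedPairRowT.of_forestTreeTBRowsHalfAuto_box
    (r R vmax : ℕ) (h7R : 7 ≤ R) (hrR : r + 1 ≤ R) (hvR : r + vmax ≤ R)
    (U : ℚ) (hU : 0 ≤ U) (n₀ : ℚ) (hn0 : 0 ≤ n₀) (hn2 : n₀ < 2) (sA sB : ℚ) (Bkey : ℕ)
    (X : ℝ → FermionOp (box 2 7))
    (EBA EBB : List (Terms (Orb (Fin (boxN r))))) (hEB : EBB = EBA)
    -- vertex A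
    (DA : QuotData (boxN R) (boxN r)) (hDA : DA = boxQuot r R vmax)
    (THA : Terms (Orb (Fin (boxN R)))) (hTHA : THA = hamTermsBox R 1 sA U)
    (TEA : Terms (Orb (Fin (boxN R)))) (hTEA : TEA = energyTermsIdx 1 sA U (boxIx R))
    (oA : Fin 2 → Orb (Fin (boxN R))) (hoA : oA = fun σ => orb (boxIx R 0) σ)
    (TXA : Terms (Orb (Fin (boxN R)))) (hXA : termOp (boxD R) TXA = fermionEmbed (PolySite.incl (box_subset_boxW h7R)) (X (sA : ℝ)))
    (μA : Fin 2 → ℚ) (νA κA capA κA' flA : ℚ)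
    (KA : ℕ) (blocksA : List (List (List ℤ × Terms (Orb (Fin (boxN R))))))
    (CWA : Terms (Orb (Fin (boxN R)))) (hcwA : ∀ wc ∈ CWA, chargeW wc.1 ≠ 0 ∨ spinChargeW (fun a => (ofLex a).2) wc.1 ≠ 0)
    (AVA : List (Terms (Orb (Fin (boxN R)))))
    (nsA : List ℕ) (HsA : List (List (QHint (boxN r)))) (segsA : List Seg)
    (hforestA : ForestFrom DA Bkey
      (groupSlices (residTGslicesNear TXA μA νA oA κA capA κA' flA TEA (gramTBRowsHalf KA blocksA) THA DA.f EBA (autoMasks THA DA.f EBA)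
        (fun l : Fin 0 => l.elim0) (fun l : Fin 0 => l.elim0) CWA AVA) nsA) HsA 0 segsA)
    (CfinA : SOSDual.EncPoly) (hfinA : MergesTo Bkey (ends segsA) CfinA)
    {βA : ℚ}
    (hβA : haveI := neZero_boxN R; βA ≤ lowerConst (SOSDual.decPoly (boxN R) CfinA) + (μA 0 + μA 1) * (n₀ / 2 - νA))
    -- vertex B
    (DB : QuotData (boxN R) (boxN r)) (hDB : DB = boxQuot r R vmax)
    (THB : Terms (Orb (Fin (boxN R)))) (hTHB : THB = hamTermsBox R 1 sB U)
    (TEB : Terms (Orb (Fin (boxN R)))) (hTEB : TEB = energyTermsIdx 1 sB U (boxIx R))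
    (oB : Fin 2 → Orb (Fin (boxN R))) (hoB : oB = fun σ => orb (boxIx R 0) σ)
    (TXB : Terms (Orb (Fin (boxN R)))) (hXB : termOp (boxD R) TXB = fermionEmbed (PolySite.incl (box_subset_boxW h7R)) (X (sB : ℝ)))
    (μB : Fin 2 → ℚ) (νB κB capB κB' flB : ℚ)
    (KB : ℕ) (blocksB : List (List (List ℤ × Terms (Orb (Fin (boxN R))))))
    (CWB : Terms (Orb (Fin (boxN R)))) (hcwB : ∀ wc ∈ CWB, chargeW wc.1 ≠ 0 ∨ spinChargeW (fun a => (ofLex a).2) wc.1 ≠ 0)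
    (AVB : List (Terms (Orb (Fin (boxN R)))))
    (nsB : List ℕ) (HsB : List (List (QHint (boxN r)))) (segsB : List Seg)
    (hforestB : ForestFrom DB Bkey
      (groupSlices (residTGslicesNear TXB μB νB oB κB capB κB' flB TEB (gramTBRowsHalf KB blocksB) THB DB.f EBB (autoMasks THB DB.f EBB)
        (fun l : Fin 0 => l.elim0) (fun l : Fin 0 => l.elim0) CWB AVB) nsB) HsB 0 segsB)
    (CfinB : SOSDual.EncPoly) (hfinB : MergesTo Bkey (ends segsB) CfinB)
    {βB : ℚ}
    (hβB : haveI := neZero_boxN R; βB ≤ lowerConst (SOSDual.decPoly (boxN R) CfinB) + (μB 0 + μB 1) * (n₀ / 2 - νB))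
    : SquareTTPrimePinnedPairRowT (U : ℝ) (n₀ : ℝ) (sA : ℝ) (sB : ℝ) capA capB flA flB βA κA κA' βB κB κB' X := by
  haveI : NeZero (boxN R) := neZero_boxN R
  exact SquareTTPrimePinnedPairRowT.of_forestTBRowsHalfAuto_box r R vmax h7R hrR hvR U hU n₀ hn0 hn2 sA sB Bkey X EBA EBB hEB
    DA hDA THA hTHA TEA hTEA oA hoA TXA hXA μA νA κA capA κA' flA KA blocksA CWA hcwA AVA nsA HsA segsA hforestA CfinA
    (hfinA.evalPoly_eq (boxD R)) hβA
    DB hDB THB hTHB TEB hTEB oB hoB TXB hXB μB νB κB capB κB' flB KB blocksB CWB hcwB AVB nsB HsB segsB hforestB CfinB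
    (hfinB.evalPoly_eq (boxD R)) hβB

end KernelPairForestTree

end Summit.Ventures.CertifiedManyBodySolver.Downfold

end
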